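import Summits.HubbardSuperconductivity.HubbardSuperconductivity.Theorems.AnisotropyChordTransferFibre3FinX3Eval

/-!
# Route `AnisotropyChord` / H0 rotor rung: FIN per-`L` GM₃ (X5), `L = 26` — rows `N₁` / D / side-condition cell facts, part `p48`

Kernel facts (`decide +kernel`) for cert cells 115, 116 of the per-`L` grid of `L = 26`: `xbnCellAny2` (row `N₁` on XB2 point wedges recomputed in the kernel, exporting the literal brackets `nt ⊇ T⁺ − 3λ₂` and `tb ⊇ T⁺·D`), `xdCellAnyN0` (row D, reads `nt`), `sdCellAnyZN` (side condition, reads `nt`); evaluators `…FinX3Eval` / `…FinX5Eval`; constants from the compiled design probe (x3probe/x3plan, margins c ×0.985, b ×1.03, aD ×1.03); assembled in `…FinX5GM3TwentySix`.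
Prover seat `hubbard-h0-rotor-p3` g8; helper for piece A = stmt-HubbardSuperconductivity-23918 of rung 19089 (`--supports`, helper class).
WHAT THIS IS NOT: nothing here proves superconductivity in the Hubbard model (rotor TARGET as worded stays FALSE, g15 verdict); kernel facts for the FIN certificate of ONE conditional reduction.  Tree imports only; zero data; standard axioms.
-/

set_option linter.dupNamespace false
set_option autoImplicit false

namespace Summit.HubbardSuperconductivity.HubbardSuperconductivity.Theorems.AnisotropyChord.Transfer.Fibre3

namespace FinXD

open FinXB FinCell Hole2

set_option maxHeartbeats 4000000 in
/-- row `N₁` of cell 115 of `L = 26` (`c = 29/50`), exporting `nt`, `tb`. [folklore] -/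
theorem xn26_115 : xbnCellAny2 26 (49/50 : ℚ) 1353817768625580 1387663212841220 (29/50 : ℚ) ((12567595862612 : ℤ), (22447409043899 : ℤ)) ((4073996112595640 : ℤ), (4185461836711271 : ℤ)) = true := by decide +kernel

set_option maxHeartbeats 4000000 in
/-- row D of cell 115 of `L = 26` (`aD = 39/500`). [folklore] -/
theorem xd26_115 : xdCellAnyN0 26 (49/50 : ℚ) 1353817768625580 1387663212841220 (39/500 : ℚ) ((12567595862612 : ℤ), (22447409043899 : ℤ)) = true := by decide +kernel

set_option maxHeartbeats 4000000 in
/-- side condition of cell 115 of `L = 26` (`c, b = 92/100, aD`). [folklore] -/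
theorem sd26_115 : sdCellAnyZN 26 (49/50 : ℚ) 100 1353817768625580 1387663212841220 ((29/50 : ℚ), (92 : ℕ), (39/500 : ℚ)) ((12567595862612 : ℤ), (22447409043899 : ℤ)) = true := by decide +kernel

set_option maxHeartbeats 4000000 in
/-- row `N₁` of cell 116 of `L = 26` (`c = 29/50`), exporting `nt`, `tb`. [folklore] -/
theorem xn26_116 : xbnCellAny2 26 (49/50 : ℚ) 1387663212841220 1422354793162251 (29/50 : ℚ) ((13620214119464 : ℤ), (23870768362165 : ℤ)) ((4176584443770819 : ℤ), (4290960556721223 : ℤ)) = true := by decide +kernel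

set_option maxHeartbeats 4000000 in
/-- row D of cell 116 of `L = 26` (`aD = 39/500`). [folklore] -/
theorem xd26_116 : xdCellAnyN0 26 (49/50 : ℚ) 1387663212841220 1422354793162251 (39/500 : ℚ) ((13620214119464 : ℤ), (23870768362165 : ℤ)) = true := by decide +kernel

set_option maxHeartbeats 4000000 in
/-- side condition of cell 116 of `L = 26` (`c, b = 93/100, aD`). [folklore] -/
theorem sd26_116 : sdCellAnyZN 26 (49/50 : ℚ) 100 1387663212841220 1422354793162251 ((29/50 : ℚ), (93 : ℕ), (39/500 : ℚ)) ((13620214119464 : ℤ), (23870768362165 : ℤ)) = true := by decide +kernel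

end FinXD

end Summit.HubbardSuperconductivity.HubbardSuperconductivity.Theorems.AnisotropyChord.Transfer.Fibre3
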